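import Summits.QuantumFields.YangMills.Theses.FluxSectorLaplace
import Summits.QuantumFields.YangMills.Theorems.QuantileBitPuritySectors
import HarnessLib

/-!
# Route `FluxSectorLaplace` (YangMills): the support item `SectorWeightMonotone` (stmt-QuantumFields-24082) holds BY NAME

`SectorWeightMonotone := ∀ L [NeZero L] β n z A, MeasurableSet A → 0 ≤ β →
  0 ≤ TT.sectorWeight β n z (𝟙_A(U₀)) ∧ TT.sectorWeight β n z (𝟙_A(U₀)) ≤ TT.sectorWeight β n z 1` — the seam-sector weight of a
slice-`0` event is non-negative and at most the sector's total weight (the seam-closed transfer chain is a non-negative integrand;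
`integral_mono` on `(slices) × (seam field)`).  Both halves are instances of the landed module `QuantileBitPuritySectors`
(seat ym-dw-p1 g14, p694102): `TT.sectorWeight_nonneg` and `TT.sectorWeight_mono` (with the indicator's measurability
`TT.measurable_uncurry_slice_zero` and the bound `|𝟙_A| ≤ 1`).  The hypothesis `0 ≤ β` of the route statement is not needed.

HONEST FRAMING: fixed-lattice bookkeeping (a by-name bridge); the route's cruxes are OPEN; no summit conjunct is touched; the
Yang–Mills mass gap is NOT proved.  No `sorry`, no new axiom, no new definition.
References: [cite: MontvayMunster1994, (3.145)]; [cite: Luscher1983, §2].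
-/

set_option autoImplicit false

open Function

namespace Summit.QuantumFields.YangMills.Theorems.FluxSectorLaplace

/-- **`SectorWeightMonotone` holds** (item stmt-QuantumFields-24082 of route `FluxSectorLaplace`, BY NAME): for every `L`, `β`,
`n`, seam twist `z` and measurable slice event `A`, `0 ≤ W_z(𝟙_A(U₀)) ≤ W_z(1)` — `TT.sectorWeight_nonneg` and `TT.sectorWeight_mono`.
[cite: MontvayMunster1994, (3.145)] [cite: Luscher1983, §2] -/
theorem sectorWeightMonotone_proof :
    Summit.QuantumFields.YangMills.Theses.FluxSectorLaplace.SectorWeightMonotone := by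
  intro L _ β n z A hA _hβ
  refine ⟨FemtoTransferGap.TT.sectorWeight_nonneg β n z fun Us _ => Set.indicator_nonneg (fun _ _ => zero_le_one) _, ?_⟩
  exact FemtoTransferGap.TT.sectorWeight_mono β n z (C := 1)
    (FemtoTransferGap.TT.measurable_uncurry_slice_zero (measurable_const.indicator hA)) measurable_const
    (fun Us _ => FemtoTransferGap.TT.abs_indicator_one_le A (Us 0)) (fun _ _ => by rw [abs_one])
    (fun Us _ => Set.indicator_le_self' (fun _ _ => zero_le_one) (Us 0))

end Summit.QuantumFields.YangMills.Theorems.FluxSectorLaplace
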